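import Summits.Ventures.PercRepro.RankLevelSetBiIndepAbsorbStar

/-! # RankLevelSetAbsorbStarLowPairs — THE PAIR COUNT AND THE TWO EXCHANGE LEMMAS BEHIND THE FIRST TWO STEPS OF
(ABS-star) (night-1 g34; dossier §46; the theorems are in `RankLevelSetAbsorbStarLow`)

For a finite matroid `M` on `n = #E` elements and `y ∈ E`, the absorbing avoid-`y` profile is
`A^y_k = #lowAbsorbAt M y k = #{Z ∈ D_k : y ∉ Z, insert y Z dependent}` (g28/g32); g33's (ABS-star) is the
star-normalized step `(n − 1 − k) · A^y_k ≤ k · A^y_{k+1}` for `2k + 1 ≤ n` (`BiIndepAbsorbStar`). This module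
prepares the proof of the steps `k = 1, 2` for every matroid (`RankLevelSetAbsorbStarLow`): the absorbing family as a
`Finset` of `Finset`s (`absorbFinset`, `lowAbsorbCount_eq_card`), the `(n − k − 1) · A^y_k` PAIRS `(Z, e)` with
`Z ∈ A^y_k`, `e ∈ E ∖ (Z ∪ {y})` (`absorbPairs`, `card_absorbPairs`), the facts about a member `Z` — `y ∈ cl Z`,
`y` is a non-loop, at level `2` the EXCESS `cl Z ∖ (Z ∪ {y})` has at most one element (`excess_unique_two`) and
`E ⊄ cl Z` when `n ≥ 5` (`exists_notMem_closure_two`) — and the two exchange lemmas that bound the fibres of the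
map `(Z, e) ↦ Z ∪ {e}`: **`not_all_pairs_absorb`** (if `W = {a, b, c}` absorbs `y` then `{b, c}`, `{a, c}`,
`{a, b}` do not all absorb `y`: either `y ∥ c` and `c ∈ cl {y} ⊆ cl {a, b}`, or `a, b ∈ cl {y, c}` by the exchange
property of the closure, against the independence of `W`) and **`not_mem_lowAbsorbAt_of_excess`** (if `Z = {b, c}`
absorbs `y` with an excess element `f` and `e ∈ E ∖ cl Z`, then `{e, c}` does not absorb `y` with an independent
complement: when `y ∥ c`, `f ∈ cl {b, y} ∖ cl {y}` gives `b ∈ cl {f, y} ⊆ cl (E ∖ {e, c})`; otherwise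
`b, e ∈ cl {y, c}` and the independent `3`-set `{e, b, c}` lies in a flat of rank `≤ 2`). Nothing here asserts
(ABS-star); every declaration has a docstring; imports: the cell's own modules and Mathlib only. Axioms: standard. -/

namespace PercRepro

open Set Matroid

variable {α : Type} [DecidableEq α] (M : Matroid α) [M.Finite]

/-! ## The absorbing family as a `Finset` of `Finset`s -/

/-- The ground set as a `Finset`. -/
noncomputable def absGround : Finset α := M.ground_finite.toFinset

omit [DecidableEq α] in
/-- `e ∈ absGround M ↔ e ∈ M.E`. -/
lemma mem_absGround {e : α} : e ∈ absGround M ↔ e ∈ M.E := by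
  simp [absGround]

omit [DecidableEq α] in
/-- `#absGround M = #E`. -/
lemma card_absGround : (absGround M).card = M.E.ncard := by
  rw [absGround, Set.ncard_eq_toFinset_card M.E M.ground_finite]

open Classical in
/-- **The absorbing avoid-`y` family at level `k`, as a `Finset` of `Finset`s** (the members of `lowAbsorbAt`). -/
noncomputable def absorbFinset (y : α) (k : ℕ) : Finset (Finset α) :=
  (absGround M).powerset.filter (fun Z => (↑Z : Set α) ∈ lowAbsorbAt M y k)

omit [DecidableEq α] in
/-- Membership in `absorbFinset`: the coerced set is a member of `lowAbsorbAt`. -/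
lemma mem_absorbFinset {y : α} {k : ℕ} {Z : Finset α} :
    Z ∈ absorbFinset M y k ↔ (↑Z : Set α) ∈ lowAbsorbAt M y k := by
  simp only [absorbFinset, Finset.mem_filter, Finset.mem_powerset, and_iff_right_iff_imp]
  rintro ⟨⟨hZE, -, -, -⟩, -, -⟩ e he
  exact (mem_absGround M).mpr (hZE he)

omit [DecidableEq α] in
/-- `lowAbsorbAt M y k` is the image of `absorbFinset M y k` under the coercion `Finset α → Set α`. -/
lemma lowAbsorbAt_eq_image (y : α) (k : ℕ) :
    lowAbsorbAt M y k = (fun Z : Finset α => (↑Z : Set α)) '' ↑(absorbFinset M y k) := by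
  ext Z
  constructor
  · intro hZ
    have hZfin : Z.Finite := M.ground_finite.subset hZ.1.1
    refine ⟨hZfin.toFinset, ?_, hZfin.coe_toFinset⟩
    rw [Finset.mem_coe, mem_absorbFinset, hZfin.coe_toFinset]
    exact hZ
  · rintro ⟨Z', hZ', rfl⟩
    rw [Finset.mem_coe, mem_absorbFinset] at hZ'
    exact hZ'

omit [DecidableEq α] in
/-- **`A^y_k` is the cardinality of `absorbFinset M y k`.** -/
lemma lowAbsorbCount_eq_card (y : α) (k : ℕ) : lowAbsorbCount M y k = (absorbFinset M y k).card := by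
  rw [lowAbsorbCount, lowAbsorbAt_eq_image, Set.ncard_image_of_injective _ Finset.coe_injective,
    Set.ncard_coe_finset]

/-! ## The pairs `(Z, e)`, `Z ∈ A^y_k`, `e ∈ E ∖ (Z ∪ {y})` -/

/-- **The pairs** `(Z, e)` with `Z ∈ absorbFinset M y k` and `e ∈ E ∖ (Z ∪ {y})`. -/
noncomputable def absorbPairs (y : α) (k : ℕ) : Finset (Σ _ : Finset α, α) :=
  (absorbFinset M y k).sigma (fun Z => absGround M \ insert y Z)

/-- Membership in `absorbPairs`. -/
lemma mem_absorbPairs {y : α} {k : ℕ} {p : Σ _ : Finset α, α} :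
    p ∈ absorbPairs M y k ↔ p.1 ∈ absorbFinset M y k ∧ p.2 ∈ M.E ∧ p.2 ≠ y ∧ p.2 ∉ p.1 := by
  simp only [absorbPairs, Finset.mem_sigma, Finset.mem_sdiff, Finset.mem_insert, mem_absGround, not_or]

/-- For `Z ∈ absorbFinset M y k` (`y ∈ E`) there are exactly `#E − k − 1` elements `e ∈ E ∖ (Z ∪ {y})`. -/
lemma card_sdiff_insert_of_mem_absorbFinset {y : α} (hy : y ∈ M.E) {k : ℕ} {Z : Finset α}
    (hZ : Z ∈ absorbFinset M y k) : (absGround M \ insert y Z).card = M.E.ncard - k - 1 := by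
  rw [mem_absorbFinset] at hZ
  obtain ⟨⟨hZE, hZk, -, -⟩, hyZ, -⟩ := hZ
  have hsub : insert y Z ⊆ absGround M := by
    intro e he
    rw [Finset.mem_insert] at he
    rw [mem_absGround]
    rcases he with rfl | he
    · exact hy
    · exact hZE he
  rw [Finset.card_sdiff_of_subset hsub, card_absGround, Finset.card_insert_of_notMem hyZ]
  rw [Set.ncard_coe_finset] at hZk
  rw [hZk]
  omega

/-- **`#absorbPairs M y k = (#E − k − 1) · A^y_k`.** -/
lemma card_absorbPairs {y : α} (hy : y ∈ M.E) (k : ℕ) :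
    (absorbPairs M y k).card = (M.E.ncard - k - 1) * lowAbsorbCount M y k := by
  rw [absorbPairs, Finset.card_sigma, lowAbsorbCount_eq_card, mul_comm]
  exact Finset.sum_const_nat (fun Z hZ => card_sdiff_insert_of_mem_absorbFinset M hy hZ)

/-! ## Members at level `k`: `y ∈ cl Z`, `y` is a non-loop, the excess of a member at level `2` is at most one
element, and `E ⊄ cl Z` when `#E ≥ 5` -/

omit [DecidableEq α] [M.Finite] in
/-- For `Z ∈ lowAbsorbAt M y k` with `y ∈ E`: `y ∈ cl Z`. -/
lemma mem_closure_of_mem_lowAbsorbAt {y : α} (hy : y ∈ M.E) {k : ℕ} {Z : Set α}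
    (hZ : Z ∈ lowAbsorbAt M y k) : y ∈ M.closure Z := by
  obtain ⟨⟨hZE, -, hZind, -⟩, hyZ, hdep⟩ := hZ
  rw [hZind.mem_closure_iff_of_notMem hyZ]
  exact ⟨hdep, Set.insert_subset hy hZE⟩

omit [DecidableEq α] [M.Finite] in
/-- For `Z ∈ lowAbsorbAt M y k` with `y ∈ E`: `{y}` is independent (`y` lies in the independent set `E ∖ Z`). -/
lemma indep_singleton_of_mem_lowAbsorbAt {y : α} (hy : y ∈ M.E) {k : ℕ} {Z : Set α}
    (hZ : Z ∈ lowAbsorbAt M y k) : M.Indep {y} := by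
  obtain ⟨⟨-, -, -, hcind⟩, hyZ, -⟩ := hZ
  exact hcind.subset (Set.singleton_subset_iff.mpr ⟨hy, hyZ⟩)

omit [DecidableEq α] in
/-- **The excess of a member at level `2` is at most one element**: two elements of `cl Z ∖ (Z ∪ {y})` coincide
(`{f, g, y} ⊆ E ∖ Z` would be an independent `3`-set inside the rank-`2` flat `cl Z`). -/
lemma excess_unique_two {y : α} (hy : y ∈ M.E) {Z : Set α} (hZ : Z ∈ lowAbsorbAt M y 2) {f g : α}
    (hf : f ∈ M.closure Z) (hfZ : f ∉ Z) (hfy : f ≠ y) (hg : g ∈ M.closure Z) (hgZ : g ∉ Z) (hgy : g ≠ y) :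
    f = g := by
  by_contra hfg
  have hycl : y ∈ M.closure Z := mem_closure_of_mem_lowAbsorbAt M hy hZ
  obtain ⟨⟨hZE, hZk, hZind, hcind⟩, hyZ, -⟩ := hZ
  have hfE : f ∈ M.E := M.closure_subset_ground Z hf
  have hgE : g ∈ M.E := M.closure_subset_ground Z hg
  have hsub : ({f, g, y} : Set α) ⊆ M.E \ Z := by
    intro x hx
    simp only [Set.mem_insert_iff, Set.mem_singleton_iff] at hx
    rcases hx with rfl | rfl | rfl
    · exact ⟨hfE, hfZ⟩
    · exact ⟨hgE, hgZ⟩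
    · exact ⟨hy, hyZ⟩
  have hind : M.Indep {f, g, y} := hcind.subset hsub
  have hsubcl : ({f, g, y} : Set α) ⊆ M.closure Z := by
    intro x hx
    simp only [Set.mem_insert_iff, Set.mem_singleton_iff] at hx
    rcases hx with rfl | rfl | rfl
    · exact hf
    · exact hg
    · exact hycl
  have h1 := hind.encard_le_eRk_of_subset hsubcl
  have hfgy : f ∉ ({g, y} : Set α) := by
    simp only [Set.mem_insert_iff, Set.mem_singleton_iff, not_or]
    exact ⟨hfg, hfy⟩
  rw [M.eRk_closure_eq, hZind.eRk_eq_encard, ← Set.Finite.cast_ncard_eq (M.ground_finite.subset hZE), hZk,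
    Set.encard_insert_of_notMem hfgy, Set.encard_pair hgy] at h1
  norm_num at h1

omit [DecidableEq α] in
/-- **When `#E ≥ 5`, a member at level `2` does not span `E`**: some `e ∈ E` lies outside `cl Z` (otherwise the
independent set `E ∖ Z` of `#E − 2 ≥ 3` elements would lie in the rank-`2` flat `cl Z`). -/
lemma exists_notMem_closure_two (hn : 5 ≤ M.E.ncard) {y : α} {Z : Set α} (hZ : Z ∈ lowAbsorbAt M y 2) :
    ∃ e ∈ M.E, e ∉ M.closure Z := by
  by_contra h
  push Not at h
  obtain ⟨⟨hZE, hZk, hZind, hcind⟩, -, -⟩ := hZ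
  have hsub : M.E \ Z ⊆ M.closure Z := fun e he => h e he.1
  have h1 := hcind.encard_le_eRk_of_subset hsub
  rw [M.eRk_closure_eq, hZind.eRk_eq_encard, ← Set.Finite.cast_ncard_eq (M.ground_finite.subset hZE), hZk,
    ← Set.Finite.cast_ncard_eq (M.ground_finite.subset Set.sdiff_subset), Set.ncard_sdiff' hZE M.ground_finite,
    hZk] at h1
  have h2 : M.E.ncard - 2 ≤ 2 := by exact_mod_cast h1
  omega

/-! ## The two exchange lemmas behind the fibre bound -/

omit [DecidableEq α] [M.Finite] in
/-- A non-loop `y` in the closure of `{c}` has `c` in the closure of `{y}` (the exchange property at `∅`). -/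
lemma mem_closure_singleton_symm {y c : α} (hy : M.Indep {y}) (hyc : y ∈ M.closure {c}) :
    c ∈ M.closure {y} := by
  have hyE : y ∈ M.E := hy.subset_ground (Set.mem_singleton y)
  have hy0 : y ∉ M.closure ∅ := by
    rw [(M.empty_indep).notMem_closure_iff hyE]
    exact ⟨by simpa using hy, Set.notMem_empty y⟩
  have h := M.closure_exchange (e := y) (f := c) (X := ∅) ⟨by simpa using hyc, hy0⟩
  simpa using h.1

omit [DecidableEq α] [M.Finite] in
/-- **Not every `2`-subset of a member at level `3` is a member at level `2`**: if `W = {a, b, c}` absorbs `y`,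
then `{b, c}`, `{a, c}`, `{a, b}` cannot all absorb `y` (either `y ∥ c` and then `c ∈ cl {y} ⊆ cl {a, b}`, or
`a, b ∈ cl {y, c}` by the exchange property, against the independence of `W`). -/
lemma not_all_pairs_absorb {y a b c : α} (hy : y ∈ M.E) (hab : a ≠ b) (hac : a ≠ c) (hbc : b ≠ c)
    (hW : ({a, b, c} : Set α) ∈ lowAbsorbAt M y 3) (h1 : ({b, c} : Set α) ∈ lowAbsorbAt M y 2)
    (h2 : ({a, c} : Set α) ∈ lowAbsorbAt M y 2) (h3 : ({a, b} : Set α) ∈ lowAbsorbAt M y 2) : False := by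
  have hy1 : M.Indep {y} := indep_singleton_of_mem_lowAbsorbAt M hy hW
  have hybc : y ∈ M.closure {b, c} := mem_closure_of_mem_lowAbsorbAt M hy h1
  have hyac : y ∈ M.closure {a, c} := mem_closure_of_mem_lowAbsorbAt M hy h2
  have hyab : y ∈ M.closure {a, b} := mem_closure_of_mem_lowAbsorbAt M hy h3
  obtain ⟨⟨hWE, -, hWind, -⟩, hyW, -⟩ := hW
  by_cases hyc : y ∈ M.closure {c}
  · -- `c ∈ cl {y} ⊆ cl {a, b}`, so `W = insert c {a, b}` is dependent
    have hc : c ∈ M.closure {y} := mem_closure_singleton_symm M hy1 hyc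
    have hcab : c ∈ M.closure {a, b} :=
      M.closure_subset_closure_of_subset_closure (Set.singleton_subset_iff.mpr hyab) hc
    have hcab' : c ∉ ({a, b} : Set α) := by
      simp only [Set.mem_insert_iff, Set.mem_singleton_iff, not_or]
      exact ⟨fun h => hac h.symm, fun h => hbc h.symm⟩
    have hind : M.Indep (insert c {a, b}) := by
      have : insert c ({a, b} : Set α) = {a, b, c} := by
        ext x; simp only [Set.mem_insert_iff, Set.mem_singleton_iff]; tauto
      rw [this]; exact hWind
    rw [(hWind.subset (by intro x hx; simp only [Set.mem_insert_iff, Set.mem_singleton_iff] at hx ⊢; tauto)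
      : M.Indep ({a, b} : Set α)).insert_indep_iff_of_notMem hcab'] at hind
    exact hind.2 hcab
  · -- `a, b ∈ cl {y, c}`, so the independent `3`-set `W` lies in a flat of rank `≤ 2`
    have hb : b ∈ M.closure (insert y {c}) := (M.closure_exchange ⟨hybc, hyc⟩).1
    have ha : a ∈ M.closure (insert y {c}) := (M.closure_exchange ⟨hyac, hyc⟩).1
    have hc : c ∈ M.closure (insert y {c}) := M.subset_closure _
      (by intro x hx; simp only [Set.mem_insert_iff, Set.mem_singleton_iff] at hx
          rcases hx with rfl | rfl
          · exact hy
          · exact hWE (by simp)) (Set.mem_insert_of_mem _ (Set.mem_singleton c))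
    have hsub : ({a, b, c} : Set α) ⊆ M.closure (insert y {c}) := by
      intro x hx
      simp only [Set.mem_insert_iff, Set.mem_singleton_iff] at hx
      rcases hx with rfl | rfl | rfl
      · exact ha
      · exact hb
      · exact hc
    have h1 := hWind.encard_le_eRk_of_subset hsub
    have hyc' : y ≠ c := fun h => hyW (by simp [h])
    have habc : a ∉ ({b, c} : Set α) := by
      simp only [Set.mem_insert_iff, Set.mem_singleton_iff, not_or]; exact ⟨hab, hac⟩
    rw [M.eRk_closure_eq, Set.encard_insert_of_notMem habc, Set.encard_pair hbc] at h1
    have h2 := h1.trans (M.eRk_le_encard _)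
    rw [Set.encard_pair hyc'] at h2
    norm_num at h2

omit [DecidableEq α] [M.Finite] in
/-- **An excess element of a member at level `2` kills the other `2`-subsets of its extensions**: if
`Z = {b, c}` absorbs `y` with an excess element `f ∈ cl Z ∖ (Z ∪ {y})` and `e ∈ E ∖ cl Z`, then `{e, c}` does not
absorb `y` with an independent complement. (When `y ∥ c`: `f ∈ cl {b, y} ∖ cl {y}` gives `b ∈ cl {f, y}`, but
`{f, y, b} ⊆ E ∖ {e, c}` is independent. Otherwise `b, e ∈ cl {y, c}` by the exchange property, and the independent
`3`-set `{e, b, c}` lies in a flat of rank `≤ 2`.) -/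
lemma not_mem_lowAbsorbAt_of_excess {y b c e f : α} (hy : y ∈ M.E) (hbc : b ≠ c)
    (hZ : ({b, c} : Set α) ∈ lowAbsorbAt M y 2) (hf : f ∈ M.closure {b, c}) (hfZ : f ∉ ({b, c} : Set α))
    (hfy : f ≠ y) (heE : e ∈ M.E) (hecl : e ∉ M.closure {b, c}) :
    ({e, c} : Set α) ∉ lowAbsorbAt M y 2 := by
  intro hW
  have hy1 : M.Indep {y} := indep_singleton_of_mem_lowAbsorbAt M hy hZ
  have hybc : y ∈ M.closure {b, c} := mem_closure_of_mem_lowAbsorbAt M hy hZ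
  have hyec : y ∈ M.closure {e, c} := mem_closure_of_mem_lowAbsorbAt M hy hW
  obtain ⟨⟨hZE, -, hZind, hZcind⟩, hyZ, -⟩ := hZ
  obtain ⟨⟨-, -, -, hWcind⟩, -, -⟩ := hW
  have hbE : b ∈ M.E := hZE (by simp)
  have hcE : c ∈ M.E := hZE (by simp)
  have hfE : f ∈ M.E := M.closure_subset_ground _ hf
  have hbcl : b ∈ M.closure {b, c} := M.subset_closure _ hZE (by simp)
  have hbe : b ≠ e := fun h => hecl (h ▸ hbcl)
  have hfe : f ≠ e := fun h => hecl (h ▸ hf)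
  have hye : y ≠ e := fun h => hecl (h ▸ hybc)
  have hyc : y ≠ c := fun h => hyZ (by simp [h])
  have hfc : f ≠ c := fun h => hfZ (by simp [h])
  by_cases hyc' : y ∈ M.closure {c}
  · -- `y ∥ c`: `cl {b, c} ⊆ cl {b, y}`, `f ∉ cl {y}`, exchange gives `b ∈ cl {f, y}`
    have hc : c ∈ M.closure {y} := mem_closure_singleton_symm M hy1 hyc'
    have hsub : ({b, c} : Set α) ⊆ M.closure {b, y} := by
      intro x hx
      simp only [Set.mem_insert_iff, Set.mem_singleton_iff] at hx
      rcases hx with rfl | rfl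
      · exact M.subset_closure _ (Set.insert_subset hbE (Set.singleton_subset_iff.mpr hy)) (by simp)
      · exact M.closure_subset_closure (Set.singleton_subset_iff.mpr (by simp)) hc
    have hfby : f ∈ M.closure (insert b {y}) := M.closure_subset_closure_of_subset_closure hsub hf
    have hfy' : f ∉ M.closure {y} := by
      rw [hy1.notMem_closure_iff_of_notMem (by simpa using hfy) hfE]
      exact hZcind.subset (by
        intro x hx
        simp only [Set.mem_insert_iff, Set.mem_singleton_iff] at hx
        rcases hx with rfl | rfl
        · exact ⟨hfE, hfZ⟩
        · exact ⟨hy, hyZ⟩)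
    have hb : b ∈ M.closure (insert f {y}) := (M.closure_exchange ⟨hfby, hfy'⟩).1
    have hind : M.Indep (insert b (insert f {y})) := hWcind.subset (by
      intro x hx
      simp only [Set.mem_insert_iff, Set.mem_singleton_iff] at hx
      rcases hx with rfl | rfl | rfl
      · exact ⟨hbE, by simp only [Set.mem_insert_iff, Set.mem_singleton_iff, not_or]; exact ⟨hbe, hbc⟩⟩
      · exact ⟨hfE, by simp only [Set.mem_insert_iff, Set.mem_singleton_iff, not_or]; exact ⟨hfe, hfc⟩⟩
      · exact ⟨hy, by simp only [Set.mem_insert_iff, Set.mem_singleton_iff, not_or]; exact ⟨hye, hyc⟩⟩)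
    have hbfy : b ∉ (insert f {y} : Set α) := by
      simp only [Set.mem_insert_iff, Set.mem_singleton_iff, not_or]
      exact ⟨fun h => hfZ (by simp [h]), fun h => hyZ (by simp [h])⟩
    rw [(hind.subset (Set.subset_insert _ _)).insert_indep_iff_of_notMem hbfy] at hind
    exact hind.2 hb
  · -- `b, e ∈ cl {y, c}` by exchange; `{e, b, c}` is independent of size `3`
    have hb : b ∈ M.closure (insert y {c}) := (M.closure_exchange ⟨hybc, hyc'⟩).1
    have he : e ∈ M.closure (insert y {c}) := (M.closure_exchange ⟨hyec, hyc'⟩).1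
    have hcc : c ∈ M.closure (insert y {c}) :=
      M.subset_closure _ (Set.insert_subset hy (Set.singleton_subset_iff.mpr hcE)) (by simp)
    have hebc : e ∉ ({b, c} : Set α) := fun h => hecl (M.subset_closure _ hZE h)
    have hind : M.Indep (insert e {b, c}) := (hZind.insert_indep_iff_of_notMem hebc).mpr ⟨heE, hecl⟩
    have hsub : (insert e {b, c} : Set α) ⊆ M.closure (insert y {c}) := by
      intro x hx
      simp only [Set.mem_insert_iff, Set.mem_singleton_iff] at hx
      rcases hx with rfl | rfl | rfl
      · exact he
      · exact hb
      · exact hcc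
    have h1 := hind.encard_le_eRk_of_subset hsub
    rw [M.eRk_closure_eq, Set.encard_insert_of_notMem hebc, Set.encard_pair hbc] at h1
    have h2 := h1.trans (M.eRk_le_encard _)
    rw [Set.encard_pair hyc] at h2
    norm_num at h2

end PercRepro
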